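import Summits.BirchSwinnertonDyer.BirchSwinnertonDyer.Theorems.Rank2ObservatoryCubicFieldR209492
import HarnessLib

/-!
# BirchSwinnertonDyer — rank ≥ 2 observatory: class number one of the cubic field of `-207 + 353 * X - 37 * X ^ 2 + X ^ 3` (`Δ = 209492`) — certificates at the primes 127

HONEST FRAMING: per-curve certified theorems and census instruments; no claim on BSD in rank ≥ 2.

Companion of the per-FIELD file `Rank2ObservatoryCubicFieldR209492` of the KERNEL-2DESC instrument (design
`b2b-bsdr2-cert-3/KERNEL-2DESC.md` §9e–§9g): the degree-one prime-element certificates at the primes 127 (part b).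
Split off for file size; generated by the same generator from the same checked data.
Sorry-free; axioms `propext`, `Classical.choice`, `Quot.sound`.
[cite: Marcus2018, Ch. 3 Thm. 27, Ch. 5 Cor. 2 of Thm. 37]
-/

-- single-conjunct summit: `Summit.BirchSwinnertonDyer.BirchSwinnertonDyer.…` repeats the name by design
set_option linter.dupNamespace false

noncomputable section

open scoped Classical NumberField

open Literature.NumberTheory.NumberFields Polynomial Module NumberField

namespace Summit.BirchSwinnertonDyer.BirchSwinnertonDyer.Rank2Observatory.TwoDescCubic

namespace FieldR209492

/-! ## Class number one -/

/-- Certificate at `127`: every ring map `ψ : 𝓞 K → ℤ/127` kills a prime element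
(`α ↦ 29`: `-427 + 704 * α - 36 * α ^ 2` (norm `-127`); `α ↦ 32`: `-254 + 32 * α - α ^ 2` (norm `-127`); `α ↦ 103`: `8 - 18 * α + α ^ 2` (norm `127`)). [cite: Marcus2018, Ch. 3, Thm. 27] -/
theorem cert127 (ψ : 𝓞 (CubicField (-37) 353 (-207)) →+* ZMod 127) : ∃ e : 𝓞 (CubicField (-37) 353 (-207)), ψ e = 0 ∧ Prime e := by
  refine cert_of_cases aeval_α ψ (fun t ht hF => ?_)
  have hroots : ∀ t : ZMod 127,
      t ^ 3 + (((-37) : ℤ) : ZMod 127) * t ^ 2 + ((353 : ℤ) : ZMod 127) * t + (((-207) : ℤ) : ZMod 127) = 0 → t = 29 ∨ t = 32 ∨ t = 103 := by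
    decide +kernel
  rcases hroots t hF with rfl | rfl | rfl
  · exact ⟨lin aeval_α (-427) 704 (-36), by simp only [lin, map_add, map_mul, map_pow, map_intCast, ht]; decide,
      lin_prime_of_prime irreducible aeval_α finrank_eq (-427) 704 (-36) (n := (-127))
        (by norm_num [MonicCubic.normForm]) (by norm_num)⟩
  · exact ⟨lin aeval_α (-254) 32 (-1), by simp only [lin, map_add, map_mul, map_pow, map_intCast, ht]; decide,
      lin_prime_of_prime irreducible aeval_α finrank_eq (-254) 32 (-1) (n := (-127))
        (by norm_num [MonicCubic.normForm]) (by norm_num)⟩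
  · exact ⟨lin aeval_α 8 (-18) 1, by simp only [lin, map_add, map_mul, map_pow, map_intCast, ht]; decide,
      lin_prime_of_prime irreducible aeval_α finrank_eq 8 (-18) 1 (n := 127)
        (by norm_num [MonicCubic.normForm]) (by norm_num)⟩

end FieldR209492

end Summit.BirchSwinnertonDyer.BirchSwinnertonDyer.Rank2Observatory.TwoDescCubic

end
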